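import Mathlib
import Summits.Ventures.PercRepro2.Defs
import Summits.Ventures.PercRepro2.Graph
import Summits.Ventures.PercRepro2.OneColourSwitch
import Summits.Ventures.PercRepro2.RegionHubSign
import Summits.Ventures.PercRepro2.SideSwitch
import Summits.Ventures.PercRepro2.SideSwitchFibre
import Summits.Ventures.PercRepro2.SideSwitchMono
import Summits.Ventures.PercRepro2.SideSwitchM9
import Summits.Ventures.PercRepro2.SideSwitchClosed
import Summits.Ventures.PercRepro2.SideSwitchComps
import Summits.Ventures.PercRepro2.TermSwitchDefs
import Summits.Ventures.PercRepro2.TermSwitchFibre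
import Summits.Ventures.PercRepro2.TermSwitchCompsFibre
import Summits.Ventures.PercRepro2.TermSwitchMono
import Summits.Ventures.PercRepro2.TermSwitchM9
import Summits.Ventures.PercRepro2.TermSwitchRestrict
import Summits.Ventures.PercRepro2.TermSwitchHalfCube
import Summits.Ventures.PercRepro2.TermSwitchCornerCube
import Summits.Ventures.PercRepro2.TermSwitchCornerCubeSum

/-!
# The corner-free cube theorem for a SET of `Y`-reached vertices (blind cell PercRepro2, p3 g38,
2026-08-29; `proofs/P3-POCKETRK.md` §8‴, several linking free blocks)

The corner-free half-cube theorem with the single vertex `x₀` replaced by a set `X₀` of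
vertices all required to be `Y`-reached: for a fibre-invariant `P` and vertex sets `X₀, X₁`,
`Σ_{ω ∈ Sep_H ∩ DZero_H, P ω, ∀ x ∈ X₀, x ∈ K_H(ω), ∃ x ∈ X₁, x ∈ K_H(ω)} σ_pq(ω) ≤ 0`
(`dzeroSigmaSumHP_KH_all_exists_nonpos`).  On an `H`-fibre the first condition is «no component
of a vertex of `X₀` is switched» (`forall_mem_KH_assignC_iff`), a sub-cube `{T : R ∩ T = ∅}`,
and the sum over it without the corner `{T ⊇ S}` is `corner_sum_nonpos` with the general `R`
(or the plain sub-cube `rcube_sum_nonpos` when the corner condition is void or implied).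
This is what several linking free blocks need: «every linking free block on the `Y` side» is
`∀ x ∈ X₀, x ∈ K_H` for `X₀` their vertex set.  Own work; std axioms.
-/

namespace Summit.Ventures.PercRepro2

namespace TermSwitch

open Finset Classical RegionHub OneColourSwitch SideSwitch

variable {V : Type*} {E : Type*}

section Combinatorics

variable {α : Type*} [DecidableEq α]

/-- The plain sub-cube inequality: for `R ⊆ A` and a monotone `G`,
`Σ_{T ⊆ A ∖ R} (G T − G (A ∖ T)) ≤ 0`. -/
theorem sum_rcube_nonpos (A R : Finset α) (hR : R ⊆ A) (G : Finset α → ℤ)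
    (hmono : ∀ T T', T ⊆ T' → T' ⊆ A → G T ≤ G T') :
    ∑ T ∈ (A \ R).powerset, (G T - G (A \ T)) ≤ 0 := by
  rw [Finset.sum_sub_distrib]
  -- `A ∖ T = (A ∖ R ∖ T) ∪ R` for `T ⊆ A ∖ R`
  have hcompl : ∀ T ∈ (A \ R).powerset, A \ T = (A \ R) \ T ∪ R := by
    intro T hT
    have hTA : T ⊆ A \ R := Finset.mem_powerset.1 hT
    ext x
    simp only [Finset.mem_sdiff, Finset.mem_union]
    constructor
    · rintro ⟨hxA, hxT⟩
      by_cases hxR : x ∈ R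
      · exact Or.inr hxR
      · exact Or.inl ⟨⟨hxA, hxR⟩, hxT⟩
    · rintro (⟨⟨hxA, _⟩, hxT⟩ | hxR)
      · exact ⟨hxA, hxT⟩
      · exact ⟨hR hxR, fun hxT => (Finset.mem_sdiff.1 (hTA hxT)).2 hxR⟩
  have hre : ∑ T ∈ (A \ R).powerset, G (A \ T) = ∑ T ∈ (A \ R).powerset, G (T ∪ R) := by
    rw [Finset.sum_congr rfl (fun T hT => by rw [hcompl T hT])]
    exact sum_powerset_sdiff (A \ R) (fun T => G (T ∪ R))
  rw [hre, ← Finset.sum_sub_distrib]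
  refine Finset.sum_nonpos (fun T hT => ?_)
  have hTA : T ⊆ A \ R := Finset.mem_powerset.1 hT
  have := hmono T (T ∪ R) Finset.subset_union_left
    (Finset.union_subset (hTA.trans Finset.sdiff_subset) hR)
  linarith

end Combinatorics

section Count

variable [Fintype V] [DecidableEq V] [Fintype E] [DecidableEq E]

variable {ends : E → Sym2 V}

/-- The plain sub-cube inequality on a fibre: for a representative `ρ` and a set `R` of its
components, `Σ_{T ⊆ compsH ρ ∖ R} (σ_pq(ρ_T) + σ_pq(ρ^O_T)) ≤ 0`. -/
theorem rcube_sum_nonpos {p q : V} {H : Set V} {ρ : Config E} (hρ : ρ ∈ RepH ends p q H)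
    {R : Finset (Finset V)} (hR : R ⊆ compsH ends H ρ) :
    ∑ T ∈ (compsH ends H ρ \ R).powerset,
      (sigma ends (assignC ends T ρ) p q +
        sigma ends (assignC ends T (flipOH ends H ρ)) p q) ≤ 0 := by
  set A := compsH ends H ρ with hA
  obtain ⟨hmono, _⟩ := G_mono_nonneg hρ
  have hterm : ∀ T ∈ (A \ R).powerset,
      sigma ends (assignC ends T ρ) p q + sigma ends (assignC ends T (flipOH ends H ρ)) p q =
        ((if Conn ends (assignC ends T ρ) p q then (1 : ℤ) else 0) +
          (if Conn ends (assignC ends T (flipOH ends H ρ)) p q then 1 else 0)) -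
        ((if Conn ends (assignC ends (A \ T) ρ) p q then (1 : ℤ) else 0) +
          (if Conn ends (assignC ends (A \ T) (flipOH ends H ρ)) p q then 1 else 0)) := by
    intro T hT
    exact sigma_pq_add_flipOH_C hρ ((Finset.mem_powerset.1 hT).trans Finset.sdiff_subset)
  rw [Finset.sum_congr rfl hterm]
  exact sum_rcube_nonpos A R hR _ hmono

/-- When every vertex of `X₀` is `Y`-reached in `ρ`, «every vertex of `X₀` is `Y`-reached at the
assignment `T`» means «no component of a (non-terminal) vertex of `X₀` is switched». -/
lemma forall_mem_KH_assignC_iff {p q : V} {H : Set V} {ρ : Config E}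
    (hρ : ρ ∈ RepH ends p q H) {T : Finset (Finset V)} (hT : T ⊆ compsH ends H ρ)
    {X₀ : Set V} (hK : ∀ x ∈ X₀, x ∈ KH ends H ρ) :
    (∀ x ∈ X₀, x ∈ KH ends H (assignC ends T ρ)) ↔
      ∀ C ∈ ((A0H ends H ρ).filter (fun x => x ∈ X₀)).image
        (compIn ends (↑(A0H ends H ρ) : Set V)), C ∉ T := by
  rw [KH_assignC_of_mem_RepH hρ hT]
  constructor
  · intro h C hC hCT
    obtain ⟨x, hx, rfl⟩ := Finset.mem_image.1 hC
    obtain ⟨_, hxX⟩ := Finset.mem_filter.1 hx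
    exact (h x hxX).2 (Finset.mem_coe.2 ((mem_unionT_iff_compIn_mem hT x).2 hCT))
  · intro h x hxX
    refine ⟨hK x hxX, ?_⟩
    intro hxT
    by_cases hxH : x ∈ H
    · exact (mem_A0H.1 (unionT_subset_A0H hT (Finset.mem_coe.1 hxT))).2 hxH
    · have hxA : x ∈ A0H ends H ρ := mem_A0H.2 ⟨Or.inl (hK x hxX), hxH⟩
      exact h _ (Finset.mem_image.2 ⟨x, Finset.mem_filter.2 ⟨hxA, hxX⟩, rfl⟩)
        ((mem_unionT_iff_compIn_mem hT x).1 (Finset.mem_coe.1 hxT))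

/-- The per-representative sum with the conditions «every vertex of `X₀` is in `K_H(ρ_T)`» and
«some vertex of `X₁` is in `K_H(ρ_T)`» is non-positive. -/
lemma fibre_KH_all_exists_sum_nonpos {p q : V} {H : Set V} {ρ : Config E}
    (hρ : ρ ∈ RepH ends p q H) (X₀ X₁ : Set V) :
    ∑ T ∈ (compsH ends H ρ).powerset,
      (if (∀ x ∈ X₀, x ∈ KH ends H (assignC ends T ρ)) ∧
          (∃ x ∈ X₁, x ∈ KH ends H (assignC ends T ρ)) then
        sigma ends (assignC ends T ρ) p q +
          sigma ends (assignC ends T (flipOH ends H ρ)) p q else 0) ≤ 0 := by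
  set A := compsH ends H ρ with hA
  -- a vertex of `X₀` outside the `Y`-world of `ρ`: the sum is empty
  by_cases hK : ∀ x ∈ X₀, x ∈ KH ends H ρ
  swap
  · obtain ⟨x, hx⟩ := not_forall.1 hK
    obtain ⟨hxX, hxK⟩ := Classical.not_imp.1 hx
    have hnone : ∀ T ∈ A.powerset, ¬ ∀ x ∈ X₀, x ∈ KH ends H (assignC ends T ρ) := by
      intro T hT h
      have := h x hxX
      rw [KH_assignC_of_mem_RepH hρ (Finset.mem_powerset.1 hT)] at this
      exact hxK this.1
    rw [Finset.sum_congr rfl (fun T hT => if_neg (fun h => hnone T hT h.1))]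
    simp
  set R := ((A0H ends H ρ).filter (fun x => x ∈ X₀)).image
    (compIn ends (↑(A0H ends H ρ) : Set V)) with hRdef
  have hRA : R ⊆ A := compsOf_subset
  have hcond1 : ∀ T ∈ A.powerset,
      ((∀ x ∈ X₀, x ∈ KH ends H (assignC ends T ρ)) ↔ ∀ C ∈ R, C ∉ T) :=
    fun T hT => forall_mem_KH_assignC_iff hρ (Finset.mem_powerset.1 hT) hK
  by_cases hXH : ∃ x ∈ X₁, x ∈ H
  · -- the second condition is void: the plain sub-cube
    obtain ⟨x, hxX, hxH⟩ := hXH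
    have hall : ∀ T ∈ A.powerset, (∃ x ∈ X₁, x ∈ KH ends H (assignC ends T ρ)) :=
      fun T _ => ⟨x, hxX, mem_KH_of_mem hxH _⟩
    rw [Finset.sum_congr rfl (fun T hT => by
      rw [if_congr ((and_iff_left (hall T hT)).trans (hcond1 T hT)) rfl rfl]),
      ← Finset.sum_filter]
    have hfilt : A.powerset.filter (fun T => ∀ C ∈ R, C ∉ T) = (A \ R).powerset := by
      ext T
      simp only [Finset.mem_filter, Finset.mem_powerset]
      constructor
      · rintro ⟨hTA, hRT⟩
        intro D hD
        exact Finset.mem_sdiff.2 ⟨hTA hD, fun hDR => hRT D hDR hD⟩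
      · intro hT
        exact ⟨hT.trans Finset.sdiff_subset, fun C hC hCT => (Finset.mem_sdiff.1 (hT hCT)).2 hC⟩
    rw [hfilt]
    exact rcube_sum_nonpos hρ hRA
  · have hX : ∀ x ∈ X₁, x ∉ H := fun x hx hxH => hXH ⟨x, hx, hxH⟩
    set S := ((A0H ends H ρ).filter (fun x => x ∈ X₁)).image
      (compIn ends (↑(A0H ends H ρ) : Set V)) with hSdef
    have hSA : S ⊆ A := compsOf_subset
    have hcond2 : ∀ T ∈ A.powerset,
        ((∃ x ∈ X₁, x ∈ KH ends H (assignC ends T ρ)) ↔ ¬ S ⊆ T) :=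
      fun T hT => exists_mem_KH_assignC_iff hρ (Finset.mem_powerset.1 hT) hX
    rw [Finset.sum_congr rfl (fun T hT => by
      rw [if_congr (and_congr (hcond1 T hT) (hcond2 T hT)) rfl rfl]),
      ← Finset.sum_filter]
    have hsub_iff : ∀ T, T ⊆ A \ R ↔ T ⊆ A ∧ ∀ C ∈ R, C ∉ T := by
      intro T
      constructor
      · intro hT
        exact ⟨hT.trans Finset.sdiff_subset, fun C hC hCT => (Finset.mem_sdiff.1 (hT hCT)).2 hC⟩
      · rintro ⟨hTA, hRT⟩ D hD
        exact Finset.mem_sdiff.2 ⟨hTA hD, fun hDR => hRT D hDR hD⟩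
    by_cases hRS : ∀ C ∈ R, C ∉ S
    · -- the corner-free sub-cube
      have hfilt : A.powerset.filter (fun T => (∀ C ∈ R, C ∉ T) ∧ ¬ S ⊆ T) =
          (A \ R).powerset.filter (fun T => ¬ S ⊆ T) := by
        ext T
        simp only [Finset.mem_filter, Finset.mem_powerset, hsub_iff]
        constructor
        · rintro ⟨hTA, hRT, hST⟩; exact ⟨⟨hTA, hRT⟩, hST⟩
        · rintro ⟨⟨hTA, hRT⟩, hST⟩; exact ⟨hTA, hRT, hST⟩
      rw [hfilt]
      have hS' : S ⊆ A \ R := by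
        intro D hD
        exact Finset.mem_sdiff.2 ⟨hSA hD, fun hDR => hRS D hDR hD⟩
      exact corner_sum_nonpos hρ hRA hS'
    · -- a component of `X₁` is a component of `X₀`: the corner condition is implied
      obtain ⟨C, hCR, hCS⟩ : ∃ C ∈ R, C ∈ S := by
        by_contra hcon
        exact hRS (fun C hC hCS => hcon ⟨C, hC, hCS⟩)
      have hfilt : A.powerset.filter (fun T => (∀ C ∈ R, C ∉ T) ∧ ¬ S ⊆ T) =
          (A \ R).powerset := by
        ext T
        simp only [Finset.mem_filter, Finset.mem_powerset, hsub_iff]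
        constructor
        · rintro ⟨hTA, hRT, _⟩; exact ⟨hTA, hRT⟩
        · rintro ⟨hTA, hRT⟩
          exact ⟨hTA, hRT, fun hsub => hRT C hCR (hsub hCS)⟩
      rw [hfilt]
      exact rcube_sum_nonpos hρ hRA

/-- **The corner-free cube theorem for a set of `Y`-reached vertices**: for a fibre-invariant
predicate `P` and vertex sets `X₀`, `X₁`,
`Σ_{ω ∈ Sep_H ∩ DZero_H, P ω, ∀ x ∈ X₀, x ∈ K_H(ω), ∃ x ∈ X₁, x ∈ K_H(ω)} σ_pq(ω) ≤ 0`. -/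
theorem dzeroSigmaSumHP_KH_all_exists_nonpos (p q : V) (H : Set V) (P : Config E → Prop)
    (hPa : ∀ ρ ∈ RepH ends p q H, ∀ T ⊆ compsH ends H ρ, (P (assignC ends T ρ) ↔ P ρ))
    (hPO : ∀ ρ ∈ RepH ends p q H, (P (flipOH ends H ρ) ↔ P ρ)) (X₀ X₁ : Set V) :
    (∑ ω : Config E, if sepH ends p q H ω ∧ DZeroH ends H ω ∧ P ω ∧
      (∀ x ∈ X₀, x ∈ KH ends H ω) ∧ (∃ x ∈ X₁, x ∈ KH ends H ω) then
        sigma ends ω p q else 0) ≤ 0 := by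
  set S₀ : ℤ := ∑ ω : Config E, if sepH ends p q H ω ∧ DZeroH ends H ω ∧ P ω ∧
    (∀ x ∈ X₀, x ∈ KH ends H ω) ∧ (∃ x ∈ X₁, x ∈ KH ends H ω) then sigma ends ω p q else 0
    with hS₀
  have hsum : S₀ =
      ∑ ρ ∈ RepH ends p q H, if P ρ then ∑ T ∈ (compsH ends H ρ).powerset,
        (if (∀ x ∈ X₀, x ∈ KH ends H (assignC ends T ρ)) ∧
            (∃ x ∈ X₁, x ∈ KH ends H (assignC ends T ρ)) then
          sigma ends (assignC ends T ρ) p q else 0)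
      else 0 := by
    have h1 : S₀ =
        ∑ ω ∈ DZeroSetH ends p q H,
          if P ω ∧ (∀ x ∈ X₀, x ∈ KH ends H ω) ∧ (∃ x ∈ X₁, x ∈ KH ends H ω) then
            sigma ends ω p q else 0 := by
      have hset : DZeroSetH ends p q H =
          univ.filter (fun ω => sepH ends p q H ω ∧ DZeroH ends H ω) := by
        ext ω; simp [DZeroSetH, SepSetH]
      rw [hset, Finset.sum_filter, hS₀]
      refine Finset.sum_congr rfl (fun ω _ => ?_)
      by_cases h1 : sepH ends p q H ω ∧ DZeroH ends H ω
      · by_cases h2 : P ω ∧ (∀ x ∈ X₀, x ∈ KH ends H ω) ∧ (∃ x ∈ X₁, x ∈ KH ends H ω)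
        · rw [if_pos ⟨h1.1, h1.2, h2.1, h2.2.1, h2.2.2⟩, if_pos h1, if_pos h2]
        · rw [if_neg (fun h => h2 ⟨h.2.2.1, h.2.2.2.1, h.2.2.2.2⟩), if_pos h1, if_neg h2]
      · rw [if_neg (fun h => h1 ⟨h.1, h.2.1⟩), if_neg h1]
    rw [h1, sum_dzeroH_eq_sum_repH_comps (fun ω =>
      if P ω ∧ (∀ x ∈ X₀, x ∈ KH ends H ω) ∧ (∃ x ∈ X₁, x ∈ KH ends H ω) then
        sigma ends ω p q else 0)]
    refine Finset.sum_congr rfl (fun ρ hρ => ?_)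
    by_cases hP : P ρ
    · rw [if_pos hP]
      refine Finset.sum_congr rfl (fun T hT => ?_)
      have hPT := (hPa ρ hρ T (Finset.mem_powerset.1 hT)).2 hP
      by_cases hK : (∀ x ∈ X₀, x ∈ KH ends H (assignC ends T ρ)) ∧
          (∃ x ∈ X₁, x ∈ KH ends H (assignC ends T ρ))
      · rw [if_pos ⟨hPT, hK.1, hK.2⟩, if_pos hK]
      · rw [if_neg (fun h => hK ⟨h.2.1, h.2.2⟩), if_neg hK]
    · rw [if_neg hP]
      refine Finset.sum_eq_zero (fun T hT => ?_)
      rw [if_neg (fun h => hP ((hPa ρ hρ T (Finset.mem_powerset.1 hT)).1 h.1))]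
  have hsumO : (∑ ρ ∈ RepH ends p q H, if P ρ then ∑ T ∈ (compsH ends H ρ).powerset,
        (if (∀ x ∈ X₀, x ∈ KH ends H (assignC ends T ρ)) ∧
            (∃ x ∈ X₁, x ∈ KH ends H (assignC ends T ρ)) then
          sigma ends (assignC ends T ρ) p q else 0) else 0) =
      ∑ ρ ∈ RepH ends p q H, if P ρ then ∑ T ∈ (compsH ends H ρ).powerset,
        (if (∀ x ∈ X₀, x ∈ KH ends H (assignC ends T ρ)) ∧
            (∃ x ∈ X₁, x ∈ KH ends H (assignC ends T ρ)) then
          sigma ends (assignC ends T (flipOH ends H ρ)) p q else 0) else 0 := by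
    symm
    refine Finset.sum_nbij' (fun ρ => flipOH ends H ρ) (fun ρ => flipOH ends H ρ)
      (fun ρ hρ => flipOH_mem_RepH hρ) (fun ρ hρ => flipOH_mem_RepH hρ)
      (fun ρ _ => flipOH_flipOH H ρ) (fun ρ _ => flipOH_flipOH H ρ) ?_
    intro ρ hρ
    rw [compsH_flipOH]
    by_cases hP : P ρ
    · rw [if_pos hP, if_pos ((hPO ρ hρ).2 hP)]
      refine Finset.sum_congr rfl (fun T hT => ?_)
      rw [KH_assignC_flipOH (Finset.mem_powerset.1 hT)]
    · rw [if_neg hP, if_neg (fun h => hP ((hPO ρ hρ).1 h))]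
  have hkey : ∀ ρ ∈ RepH ends p q H,
      (if P ρ then ∑ T ∈ (compsH ends H ρ).powerset,
        (if (∀ x ∈ X₀, x ∈ KH ends H (assignC ends T ρ)) ∧
            (∃ x ∈ X₁, x ∈ KH ends H (assignC ends T ρ)) then
          sigma ends (assignC ends T ρ) p q +
            sigma ends (assignC ends T (flipOH ends H ρ)) p q else 0) else 0) ≤ 0 := by
    intro ρ hρ
    by_cases hP : P ρ
    · rw [if_pos hP]; exact fibre_KH_all_exists_sum_nonpos hρ X₀ X₁
    · rw [if_neg hP]
  have htwice : 2 * S₀ ≤ 0 := by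
    calc 2 * S₀ = S₀ + S₀ := by ring
      _ = (∑ ρ ∈ RepH ends p q H, if P ρ then ∑ T ∈ (compsH ends H ρ).powerset,
            (if (∀ x ∈ X₀, x ∈ KH ends H (assignC ends T ρ)) ∧
                (∃ x ∈ X₁, x ∈ KH ends H (assignC ends T ρ)) then
              sigma ends (assignC ends T ρ) p q else 0) else 0) +
          ∑ ρ ∈ RepH ends p q H, if P ρ then ∑ T ∈ (compsH ends H ρ).powerset,
            (if (∀ x ∈ X₀, x ∈ KH ends H (assignC ends T ρ)) ∧
                (∃ x ∈ X₁, x ∈ KH ends H (assignC ends T ρ)) then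
              sigma ends (assignC ends T (flipOH ends H ρ)) p q else 0) else 0 := by
          rw [← hsumO, ← hsum]
      _ = ∑ ρ ∈ RepH ends p q H, if P ρ then ∑ T ∈ (compsH ends H ρ).powerset,
            (if (∀ x ∈ X₀, x ∈ KH ends H (assignC ends T ρ)) ∧
                (∃ x ∈ X₁, x ∈ KH ends H (assignC ends T ρ)) then
              sigma ends (assignC ends T ρ) p q +
                sigma ends (assignC ends T (flipOH ends H ρ)) p q else 0) else 0 := by
          rw [← Finset.sum_add_distrib]
          refine Finset.sum_congr rfl (fun ρ _ => ?_)
          by_cases hP : P ρ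
          · simp only [if_pos hP]
            rw [← Finset.sum_add_distrib]
            refine Finset.sum_congr rfl (fun T _ => ?_)
            by_cases hK : (∀ x ∈ X₀, x ∈ KH ends H (assignC ends T ρ)) ∧
                (∃ x ∈ X₁, x ∈ KH ends H (assignC ends T ρ))
            · simp only [if_pos hK]
            · simp only [if_neg hK, add_zero]
          · simp only [if_neg hP, add_zero]
      _ ≤ 0 := Finset.sum_nonpos (fun ρ hρ => hkey ρ hρ)
  linarith

end Count

end TermSwitch

end Summit.Ventures.PercRepro2
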